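import Summits.ResolutionOfSingularities.ResolutionOfSingularities.Theorems.MarkedTransferCampaignW12SandwichFrobeniusConstants
import HarnessLib

/-!
# [OURS · L1 W1.2] The Frobenius-sandwich campaign Props HOLD: `CampaignW12SandwichTSharpNoUnit`,
# `CampaignW12SandwichNegaNoUnit`, and the span forms `SandwichNegaNoUnitOfFrobeniusSpan(Mul)`,
# `SandwichTFlatNoUnitOfFrobeniusSpan` — unconditional closures (seat res-L1-s12-pv-1)

LADDER-RESOLUTION rung L (rescue), cell `res-hironaka` (run/shared/lean/pub/res-hironaka/), RESCUE-SEED §1 slot **W1.2**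
(FROBENIUS-SANDWICH differential operators). This file CLOSES, for every prime `p` and over all data, the OURS
statements typed in the lane-signed vocabulary file `MarkedTransferCampaignW12SandwichTSharp.lean` v2 (res-L1-type-o2,
p468441 ACCEPTED 2026-08-26T21:08:27Z, append-only over p461383; ns `….Theorems.Campaign`):

* `sandwichNegaNoUnitOfFrobeniusSpan_holds : SandwichNegaNoUnitOfFrobeniusSpan p e P m`
* `sandwichNegaNoUnitOfFrobeniusSpanMul_holds : SandwichNegaNoUnitOfFrobeniusSpanMul p e P m` (K1.2's registered ALIVE
  criterion shape: only the pieces `℘posi(E,dm)`, `d ≥ 1`, that Def 5.1 consumes are bounded)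
* `sandwichTFlatNoUnitOfFrobeniusSpan_holds : SandwichTFlatNoUnitOfFrobeniusSpan ℓ e L0inf pposi P m`
* `campaignW12SandwichNegaNoUnit_holds : CampaignW12SandwichNegaNoUnit p`
* **`campaignW12SandwichTSharpNoUnit_holds : CampaignW12SandwichTSharpNoUnit p`** — THE SLOT'S CAMPAIGN PROP
  (plan/SIZED-ASK-L.md §S-s12 name; criterion form, closed over all rings `O` of characteristic `p`, all `ℓ e L0inf pposi P m`
  and all proper `M` with `℘(E,j) ⊆ M^{[p^e]}`, `j > 0`, `pposi` fed by the pieces).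

All proofs route through the structural file `MarkedTransferCampaignW12SandwichFrobeniusConstants.lean` (p467195, ns
`….Campaign.W12`: Frobenius-extended ideals are stable under every `ρ^e(O)`-linear operator, whatever its order), plus
two small additions proved here: the `Mul` bound `W12.sandwichPNega_le_span_of_mul` (the summands of Eq. (36) with
`d ≤ 0` occur only with `dm = 0`, where `℘posi(E,0) = 0`) and the coefficient-wise `∥·∥` lemmas
`W12.forgetDeg_eq_sum_coeff`, `W12.forgetDeg_mem_of_coeff_mem`, `W12.coeff_mem_of_mem_sandwichNegaBl`.
Host: MarkedTransfer `--supports stmt-ResolutionOfSingularities-15522` (WAKE-s12; L/SLOTS.md §2 W1.2); the campaign ITEM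
for `CampaignW12SandwichTSharpNoUnit` is res-L1-s12-plan-1's to file (rank 9) — this file is the proof BY NAME.

HONEST FRAMING. Nothing here is a statement of H. Hironaka's manuscript *Resolution of singularities in positive
characteristics* (2017-03-23, [Hironaka2017], lit key `paper:url-3343fd9e678b`); Def 5.1 / Eq. (36) (p.25 L31–L44) and
Def 13.2 (105)/`∥·∥` (p.67 L16–L19) are CANDIDATES [claim: Hironaka2017, status: under-review] entering only through the
typed carriers (rows 008, 015, 073, 076) re-based on `ρ^e(O)` by the OURS vocabulary. What is established is a kernel
fact about OUR objects: on the stated class NO unit is manufactured by the sandwich operators. It does NOT say which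
recorded witnesses lie in the class (kill test K1.2, res-L1-k12: per-witness certificates `℘(E,2)_ξ ⊆ 𝔪_ξ^{[2]}`; R05 #1
is of false type at `e = 1` by the box monomial `yω₁ω₂`), takes no view on GAP rows R01/R04/R08, and is not progress on
resolution of singularities in positive characteristic. BARRIER LINE (RESCUE-SEED W1.2,
`Literature.Barriers.ResolutionOfSingularities.FrobeniusTwistResolution.not_hasResolution_Spec_frobTwist`): properness
of the sandwich modules is an ideal-membership fact in `O`; no regularity / resolution statement transports across
`ρ^e(O) ⊂ O`, and nothing here may be read as such a transfer. AI proof is weaker than expert review.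
-/

noncomputable section

set_option linter.dupNamespace false -- mandated namespace of this single-conjunct summit

/-! ## Helpers over p467195 (ns `Campaign.W12`) and the three span-form closures -/

namespace Summit.ResolutionOfSingularities.ResolutionOfSingularities.Theorems.Campaign.W12

open LaurentPolynomial
open Literature.AlgebraicGeometry.Resolution
open Literature.AlgebraicGeometry.Hironaka2017
open Literature.AlgebraicGeometry.Hironaka2017.S11CoordFree (BlSub inDegree)
open Literature.AlgebraicGeometry.Hironaka2017.S12GLUED (forgetDeg fnorm)
open Summit.ResolutionOfSingularities.ResolutionOfSingularities.Theorems.Campaign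

universe w

variable {O : Type w} [CommRing O] (p : ℕ) [Fact p.Prime] [CharP O p]

/-- **Mul form of the bound.** If only the pieces Def 5.1 consumes are bounded — `℘posi(E,dm) ⊆ Q = span S` for
`d ≥ 1`, `S ⊆ ρ^e(O)` — then every sandwich negative module `℘nega_sandwich(E,−a)`, `a : ℕ`, lies in `Q` (the summands
with `d ≤ 0` occur only with `dm = 0`, where `℘posi(E,0) = 0`). [folklore] -/
theorem sandwichPNega_le_span_of_mul (e : ℕ) {S : Set O} (hS : S ⊆ Set.range (iterateFrobenius O p e))
    {P : ℕ → Ideal O} {m : ℕ} (hP : ∀ d : ℕ, 0 < d → S05NegativePart.pPosi P (d * m) ≤ Ideal.span S) (a : ℕ) :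
    sandwichPNega p e P m a ≤ Ideal.span S := by
  unfold sandwichPNega S05NegativePart.pNega S05NegativePart.pTildeNeg
  refine iSup₂_le fun d _ => ?_
  unfold S05NegativePart.DD
  refine diffIdeal_le_span e _ hS ?_
  rcases le_or_gt d 0 with hd0 | hd0
  · have h0 : (d * (m : ℤ)).toNat = 0 :=
      Int.toNat_eq_zero.mpr (mul_nonpos_of_nonpos_of_nonneg hd0 (by positivity))
    rw [h0]
    simp [S05NegativePart.pPosi]
  · obtain ⟨k, rfl⟩ := Int.eq_ofNat_of_zero_le hd0.le
    have hk : ((k : ℤ) * (m : ℤ)).toNat = k * m := by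
      rw [← Nat.cast_mul, Int.toNat_natCast]
    rw [hk]
    by_cases hkm : k * m = 0
    · simp [S05NegativePart.pPosi, hkm]
    · exact hP k (Nat.pos_of_ne_zero fun h => hkm (by simp [h]))

/-- **`SandwichNegaNoUnitOfFrobeniusSpanMul` HOLDS** (unconditionally, every `O`, `p`, `e`, `P`, `m`): a
Frobenius-span `Q ∌ 1` containing `℘posi(E,dm)` for `d ≥ 1` contains every `℘nega_sandwich(E,−a)`, so none of them
contains `1`. [folklore] -/
theorem sandwichNegaNoUnitOfFrobeniusSpanMul_holds (e : ℕ) (P : ℕ → Ideal O) (m : ℕ) :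
    SandwichNegaNoUnitOfFrobeniusSpanMul p e P m := by
  rintro Q ⟨S, hS, rfl⟩ h1 hP a _ ha1
  exact h1 (sandwichPNega_le_span_of_mul p e hS hP a ha1)

/-- **`SandwichNegaNoUnitOfFrobeniusSpan` HOLDS** (unconditionally): the structural no-unit criterion
`Campaign.W12.sandwichNegaNoUnit_of_span` (p467195) in the typer's named form. [folklore] -/
theorem sandwichNegaNoUnitOfFrobeniusSpan_holds (e : ℕ) (P : ℕ → Ideal O) (m : ℕ) :
    SandwichNegaNoUnitOfFrobeniusSpan p e P m := by
  rintro Q ⟨S, hS, rfl⟩ h1 hP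
  exact sandwichNegaNoUnit_of_span p e hS h1 hP m

variable {p}

/-- `∥x∥ = Σ_d x_d`: row 076's `forgetDeg` is the sum of the coefficients. [folklore] -/
theorem forgetDeg_eq_sum_coeff {R : Type*} [CommSemiring R] [Module R O] (x : O[T;T⁻¹]) :
    forgetDeg R O x = ∑ d ∈ x.coeff.support, x.coeff d := by
  simp [forgetDeg, Finsupp.sum]

/-- If every coefficient of `x ∈ Bl(Z)` lies in the ideal `Q`, so does `∥x∥`. [folklore] -/
theorem forgetDeg_mem_of_coeff_mem {R : Type*} [CommSemiring R] [Module R O] (Q : Ideal O) {x : O[T;T⁻¹]}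
    (hx : ∀ d : ℤ, x.coeff d ∈ Q) : forgetDeg R O x ∈ Q := by
  rw [forgetDeg_eq_sum_coeff]
  exact Q.sum_mem fun d _ => hx d

/-- Every coefficient of every element of the sandwich `℘nega ⊂ Bl(Z)` lies in `Q = span S` under the bound
`℘(E,j) ⊆ Q` (`j > 0`), `S ⊆ ρ^e(O)`. [folklore] -/
theorem coeff_mem_of_mem_sandwichNegaBl (ℓ e : ℕ) {S : Set O} (hS : S ⊆ Set.range (iterateFrobenius O p e))
    {P : ℕ → Ideal O} (hP : ∀ j, 0 < j → P j ≤ Ideal.span S) (m : ℕ) {x : O[T;T⁻¹]}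
    (hx : x ∈ sandwichNegaBl (p := p) ℓ e P m) (d : ℤ) : x.coeff d ∈ Ideal.span S := by
  revert d
  unfold sandwichNegaBl idealFamilyToBl at hx
  refine Submodule.iSup_induction _ (motive := fun x => ∀ d : ℤ, x.coeff d ∈ Ideal.span S) hx ?_ ?_ ?_
  · intro i x hxi
    unfold S11CoordFree.inDegree at hxi
    refine Submodule.span_induction ?_ ?_ ?_ ?_ hxi
    · rintro _ ⟨a, ha, rfl⟩ d
      show (C a * T i).coeff d ∈ _
      rw [← single_eq_C_mul_T, AddMonoidAlgebra.coeff_single, Finsupp.single_apply]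
      split_ifs with hid
      · have ha' : a ∈ (if i < 0 then sandwichPNega p e P m i.natAbs else ⊥ : Ideal O) := by
          simpa using ha
        split_ifs at ha' with hi
        · exact sandwichPNega_le_span p e hS hP m _ ha'
        · rw [Ideal.mem_bot] at ha'
          rw [ha']
          exact zero_mem _
      · exact zero_mem _
    · intro d
      simp
    · intro x y _ _ hx hy d
      rw [AddMonoidAlgebra.coeff_add, Finsupp.add_apply]
      exact add_mem (hx d) (hy d)
    · intro c x _ hx d
      rw [AddMonoidAlgebra.coeff_smul, Finsupp.smul_apply]
      exact Ideal.mul_mem_left _ _ (hx d)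
  · intro d
    simp
  · intro x y hx hy d
    rw [AddMonoidAlgebra.coeff_add, Finsupp.add_apply]
    exact add_mem (hx d) (hy d)

/-- **`SandwichTFlatNoUnitOfFrobeniusSpan` HOLDS** (unconditionally, every `L0inf`): with all coefficients of
`℘posi ⊂ Bl(Z)` in the Frobenius-span `Q ∌ 1` and `℘(E,j) ⊆ Q` (`j > 0`), every element of
`𝔗♯_sandwich = (𝔏_0(∞) ∩ ℘posi) + ℘nega_sandwich` has all its coefficients in `Q`, hence `∥·∥ ∈ Q` and `1 ∉ 𝔗♭`.
[folklore] -/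
theorem sandwichTFlatNoUnitOfFrobeniusSpan_holds (ℓ e : ℕ) (L0inf pposi : BlSub O p ℓ) (P : ℕ → Ideal O)
    (m : ℕ) : SandwichTFlatNoUnitOfFrobeniusSpan ℓ e L0inf pposi P m := by
  rintro Q ⟨S, hS, rfl⟩ h1 hP hposi h1T
  apply h1
  obtain ⟨x, hx, hx1⟩ := Submodule.mem_map.mp h1T
  rw [← hx1]
  refine forgetDeg_mem_of_coeff_mem _ fun d => ?_
  obtain ⟨y, hy, z, hz, rfl⟩ := Submodule.mem_sup.mp hx
  rw [AddMonoidAlgebra.coeff_add, Finsupp.add_apply]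
  exact add_mem (hposi y hy.2 d) (coeff_mem_of_mem_sandwichNegaBl ℓ e hS hP m hz d)

end Summit.ResolutionOfSingularities.ResolutionOfSingularities.Theorems.Campaign.W12

/-! ## The campaign Props, closed for every prime `p` -/

namespace Summit.ResolutionOfSingularities.ResolutionOfSingularities.Theorems.Campaign

open Literature.AlgebraicGeometry.Hironaka2017.S11CoordFree (BlSub)

universe v

/-- **`CampaignW12SandwichNegaNoUnit p` HOLDS for every prime `p`**: over every commutative ring `O` of characteristic
`p`, for every level `e`, family `P`, `m` and proper ideal `M` with `℘(E,j) ⊆ M^{[p^e]}` (`j > 0`), no sandwich negative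
module contains `1` — p467195's `W12.sandwichNegaNoUnit_of_le_frobeniusPower`, closed over the data. [folklore] -/
theorem campaignW12SandwichNegaNoUnit_holds (p : ℕ) [Fact p.Prime] : CampaignW12SandwichNegaNoUnit.{v} p :=
  fun _O _ _ e _P m _M hM hP => W12.sandwichNegaNoUnit_of_le_frobeniusPower p e hM hP m

/-- **`CampaignW12SandwichTSharpNoUnit p` HOLDS for every prime `p`** — the slot's campaign Prop (SIZED-ASK-L §S-s12,
RESCUE-SEED W1.2 «does `T♯ ∌ 1` under the sandwich operators?» in criterion form): over every commutative ring `O` of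
characteristic `p`, for all `ℓ e L0inf pposi P m` and every proper ideal `M` with `℘(E,j) ⊆ M^{[p^e]}` (`j > 0`) and
`pposi` fed by the pieces, `1 ∉ 𝔗♭_sandwich` — p467195's `W12.sandwichTFlatNoUnit_of_le_frobeniusPower`, closed over
the data. [folklore] -/
theorem campaignW12SandwichTSharpNoUnit_holds (p : ℕ) [Fact p.Prime] : CampaignW12SandwichTSharpNoUnit.{v} p :=
  fun _O _ _ ℓ e L0inf pposi _P m _M hM hP hposi =>
    W12.sandwichTFlatNoUnit_of_le_frobeniusPower p ℓ e hM hP L0inf pposi hposi m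

end Summit.ResolutionOfSingularities.ResolutionOfSingularities.Theorems.Campaign

end
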